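import Mathlib
import Summits.Ventures.HodgeRepro2.Tier7.Line3.PoincareKernel

/-!
# Tier 7 — LINE 3 support: the hyperbolic size on `SL(2, ℝ)` and the Poincaré-series kernel at a `(1,1)`-place
(`Line3/HyperbolicSize.lean`; t7-L1-p1, gen 2; Mathlib + Line3/PoincareKernel)

The archimedean components of `U(W_A)` at the places `ι₂, ι₃` are `U(1,1)`, whose derived group `SU(1,1) ≅ SL(2, ℝ)` acts
on the disc / upper half-plane `ℍ`; the memo's archimedean size of a double coset is the Cartan invariant
`κ(g) = |a(g)|² = cosh²(d(g·i, i)/2)` (L3-ARGUMENT.md §2e (a′), p1's `KappaCartan.kappa_eq_normSq`). This file instantiates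
the two displayed hypotheses of `Line3/PoincareKernel.lean` that concern the GROUP (not the lattice, not the test
function) on the REAL group `SL(2, ℝ)` with Mathlib's hyperbolic metric on `ℍ` and its isometric `SL(2, ℝ)`-action:
* the LOG-size `ρ g := dist (g • i) i` satisfies the additive shift `ρ g ≤ ρ (x⁻¹ g y) + ρ x + ρ y` (the triangle
  inequality of `ℍ` + the isometry of the action: `ρ_shift`);
* the COSH-size `κ g := cosh (ρ g)` (`= 2 |a(g)|² − 1`, the memo's `κ` up to the affine change `1 + κ = 2|a|²`) satisfies the
  MULTIPLICATIVE shift `1 + κ g ≤ (√8 κ x)(√8 κ y)(1 + κ (x⁻¹ g y))` (`κ_shift`; from `cosh(a+b+c) ≤ e^a e^b e^c ≤ 8 cosh a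
  cosh b cosh c`), is continuous (`κ_continuous`, from `ContinuousSMul SL(2, ℝ) ℍ`) and `≥ 1`; in matrix entries it is
  half the squared Hilbert–Schmidt norm, `κ g = (a² + b² + c² + d²) / 2` (`κ_eq`, `cosh_dist_smul_I`), so a bound on `κ`
  is a bound on the entries — the form in which a lattice count becomes a box count.
CONSEQUENCE (`continuous_kernelSum_SL2`): for ANY family `ι : Γ → SL(2, ℝ)` with a polynomial count in the cosh-size
(`#{γ : κ (ι γ) ≤ R} ≤ C' (1 + R)^β` — for a lattice this is the hyperbolic lattice-point count, x1/p5's rows at the model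
level) and ANY `f : SL(2, ℝ) → ℂ` continuous with `‖f g‖ ≤ C (1 + κ g)^(-α)`, `β < α` (the `D_k` matrix coefficients,
`α = k/2`, p1's Bergman rows), the Poincaré-series kernel `K_f(x, y) = Σ'_γ f (x⁻¹ (ι γ) y)` converges absolutely at every
point and is continuous on `SL(2, ℝ) × SL(2, ℝ)`. This is a statement about the real archimedean group; the count for the
real `U(W_A)(F)` and the decay of the real `f_{ι_j}` remain the line's dictionary items (TYPING-CENSUS T7).

Sorry-free; axioms: propext / Classical.choice / Quot.sound. §8(d): uses an L-value-free non-vanishing device: NO.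
-/

namespace Summit.Ventures.HodgeRepro2.Tier7.Line3.HyperbolicSize

open UpperHalfPlane Filter Topology
open scoped MatrixGroups

/-- the hyperbolic LOG-size of `g ∈ SL(2, ℝ)`: the distance from the base point `i` to `g • i`. -/
noncomputable def ρ (g : SL(2, ℝ)) : ℝ := dist (g • I) I

/-- the log-size is non-negative (a distance). -/
theorem ρ_nonneg (g : SL(2, ℝ)) : 0 ≤ ρ g := dist_nonneg

/-- **the additive shift for the log-size** = the triangle inequality of `ℍ` transported by the isometric action:
`ρ g ≤ ρ (x⁻¹ g y) + ρ x + ρ y`. -/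
theorem ρ_shift (x g y : SL(2, ℝ)) : ρ g ≤ ρ (x⁻¹ * g * y) + ρ x + ρ y := by
  unfold ρ
  have h1 : dist (g • I) I ≤ dist (g • I) (x • I) + dist (x • I) I := dist_triangle _ _ _
  have h2 : dist (g • I) (x • I) = dist ((x⁻¹ * g) • I) I := by
    rw [← dist_smul x⁻¹ (g • I) (x • I), ← mul_smul, inv_smul_smul]
  have h3 : dist ((x⁻¹ * g) • I) I ≤ dist ((x⁻¹ * g) • I) ((x⁻¹ * g * y) • I) + dist ((x⁻¹ * g * y) • I) I :=
    dist_triangle _ _ _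
  have h4 : dist ((x⁻¹ * g) • I) ((x⁻¹ * g * y) • I) = dist (y • I) I := by
    rw [mul_smul (x⁻¹ * g) y I, dist_smul, dist_comm]
  linarith

/-- `ρ` is continuous (the action of `SL(2, ℝ)` on `ℍ` is continuous). -/
theorem ρ_continuous : Continuous ρ :=
  (continuous_id.smul continuous_const).dist continuous_const

/-- the hyperbolic COSH-size `κ g := cosh (ρ g)`; in the disc model `κ = 2|a(g)|² − 1`, so `1 + κ = 2|a(g)|²` is the memo's
archimedean invariant up to the factor 2. -/
noncomputable def κ (g : SL(2, ℝ)) : ℝ := Real.cosh (ρ g)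

/-- `κ ≥ 1` (`cosh ≥ 1`). -/
theorem one_le_κ (g : SL(2, ℝ)) : 1 ≤ κ g := Real.one_le_cosh _

/-- the cosh-size is non-negative. -/
theorem κ_nonneg (g : SL(2, ℝ)) : 0 ≤ κ g := le_trans zero_le_one (one_le_κ g)

/-- `κ` is continuous. -/
theorem κ_continuous : Continuous κ := Real.continuous_cosh.comp ρ_continuous

/-- `cosh t ≤ exp t` and `exp t ≤ 2 cosh t` for `t ≥ 0`. -/
theorem cosh_le_exp {t : ℝ} (ht : 0 ≤ t) : Real.cosh t ≤ Real.exp t := by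
  rw [Real.cosh_eq]
  have : Real.exp (-t) ≤ Real.exp t := Real.exp_le_exp.2 (by linarith)
  linarith

/-- `exp t ≤ 2 cosh t`. -/
theorem exp_le_two_mul_cosh (t : ℝ) : Real.exp t ≤ 2 * Real.cosh t := by
  rw [Real.cosh_eq]
  have : 0 < Real.exp (-t) := Real.exp_pos _
  linarith

/-- the multiplicative shift of the cosh-size with the constant `8`:
`1 + κ g ≤ 8 κ x κ y (1 + κ (x⁻¹ g y))`. -/
theorem one_add_κ_le (x g y : SL(2, ℝ)) :
    1 + κ g ≤ 8 * κ x * κ y * (1 + κ (x⁻¹ * g * y)) := by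
  have hs := ρ_shift x g y
  have ha := ρ_nonneg (x⁻¹ * g * y)
  have hb := ρ_nonneg x
  have hc := ρ_nonneg y
  have hg := ρ_nonneg g
  -- `cosh (ρ g) ≤ cosh (ρ (x⁻¹ g y) + ρ x + ρ y)` (cosh increasing on `[0, ∞)`)
  have h1 : Real.cosh (ρ g) ≤ Real.cosh (ρ (x⁻¹ * g * y) + ρ x + ρ y) := by
    rw [Real.cosh_le_cosh, abs_of_nonneg hg, abs_of_nonneg (by linarith)]
    exact hs
  -- `cosh (a + b + c) ≤ e^a e^b e^c ≤ 8 cosh a cosh b cosh c`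
  have h2 : Real.cosh (ρ (x⁻¹ * g * y) + ρ x + ρ y) ≤
      (2 * Real.cosh (ρ (x⁻¹ * g * y))) * (2 * Real.cosh (ρ x)) * (2 * Real.cosh (ρ y)) := by
    calc Real.cosh (ρ (x⁻¹ * g * y) + ρ x + ρ y)
        ≤ Real.exp (ρ (x⁻¹ * g * y) + ρ x + ρ y) := cosh_le_exp (by linarith)
      _ = Real.exp (ρ (x⁻¹ * g * y)) * Real.exp (ρ x) * Real.exp (ρ y) := by
          rw [Real.exp_add, Real.exp_add]
      _ ≤ (2 * Real.cosh (ρ (x⁻¹ * g * y))) * (2 * Real.cosh (ρ x)) * (2 * Real.cosh (ρ y)) := by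
          have e1 := exp_le_two_mul_cosh (ρ (x⁻¹ * g * y))
          have e2 := exp_le_two_mul_cosh (ρ x)
          have e3 := exp_le_two_mul_cosh (ρ y)
          have p1 := Real.exp_pos (ρ (x⁻¹ * g * y))
          have p2 := Real.exp_pos (ρ x)
          have p3 := Real.exp_pos (ρ y)
          calc Real.exp (ρ (x⁻¹ * g * y)) * Real.exp (ρ x) * Real.exp (ρ y)
              ≤ (2 * Real.cosh (ρ (x⁻¹ * g * y))) * (2 * Real.cosh (ρ x)) * Real.exp (ρ y) := by
                gcongr
            _ ≤ (2 * Real.cosh (ρ (x⁻¹ * g * y))) * (2 * Real.cosh (ρ x)) * (2 * Real.cosh (ρ y)) := by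
                gcongr
  have hκa : 1 ≤ Real.cosh (ρ (x⁻¹ * g * y)) := Real.one_le_cosh _
  have hκb : 1 ≤ Real.cosh (ρ x) := Real.one_le_cosh _
  have hκc : 1 ≤ Real.cosh (ρ y) := Real.one_le_cosh _
  unfold κ
  nlinarith [mul_le_mul hκb hκc zero_le_one (by linarith : (0:ℝ) ≤ Real.cosh (ρ x))]

/-- **the multiplicative shift** in the form of `Line3/PoincareKernel.lean` §3, with `M x := √8 · κ x`. -/
theorem κ_shift (x g y : SL(2, ℝ)) :
    1 + κ g ≤ (Real.sqrt 8 * κ x) * (Real.sqrt 8 * κ y) * (1 + κ (x⁻¹ * g * y)) := by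
  have h8 : Real.sqrt 8 * Real.sqrt 8 = 8 := Real.mul_self_sqrt (by norm_num)
  calc 1 + κ g ≤ 8 * κ x * κ y * (1 + κ (x⁻¹ * g * y)) := one_add_κ_le x g y
    _ = (Real.sqrt 8 * κ x) * (Real.sqrt 8 * κ y) * (1 + κ (x⁻¹ * g * y)) := by
        rw [show (Real.sqrt 8 * κ x) * (Real.sqrt 8 * κ y) = (Real.sqrt 8 * Real.sqrt 8) * (κ x * κ y) by ring, h8]
        ring

/-! ### The cosh-size in matrix entries: `κ g = (a² + b² + c² + d²) / 2` (the Hilbert–Schmidt norm) -/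

/-- `ad − bc = 1` for the entries of `g ∈ SL(2, ℝ)`. -/
theorem det_entries (g : SL(2, ℝ)) : g 0 0 * g 1 1 - g 0 1 * g 1 0 = 1 := by
  have := g.det_coe
  rw [Matrix.det_fin_two] at this
  exact this

/-- the second row of `g ∈ SL(2, ℝ)` is not zero. -/
theorem row_ne_zero (g : SL(2, ℝ)) : (g 1 0) ^ 2 + (g 1 1) ^ 2 ≠ 0 := by
  intro h
  have hdet := det_entries g
  have h1 : g 1 0 = 0 := by nlinarith [sq_nonneg (g 1 0), sq_nonneg (g 1 1)]
  have h2 : g 1 1 = 0 := by nlinarith [sq_nonneg (g 1 0), sq_nonneg (g 1 1)]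
  rw [h1, h2] at hdet; simp at hdet

/-- `g • i = ((ac + bd) + i) / (c² + d²)` for `g = (a b; c d) ∈ SL(2, ℝ)`. -/
theorem smul_I_eq (g : SL(2, ℝ)) :
    ((g • I : ℍ) : ℂ) = ⟨(g 0 0 * g 1 0 + g 0 1 * g 1 1) / ((g 1 0) ^ 2 + (g 1 1) ^ 2),
      1 / ((g 1 0) ^ 2 + (g 1 1) ^ 2)⟩ := by
  have hdet := det_entries g
  have hcd := row_ne_zero g
  have hcd' : (g 1 1) ^ 2 + (g 1 0) ^ 2 ≠ 0 := by rw [add_comm]; exact hcd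
  have hden : ((g 1 0 : ℂ) * Complex.I + (g 1 1 : ℂ)) ≠ 0 := by
    intro h
    have h1 := congrArg Complex.re h
    have h2 := congrArg Complex.im h
    simp at h1 h2
    exact hcd (by rw [h1, h2]; ring)
  rw [coe_specialLinearGroup_apply]
  simp only [UpperHalfPlane.coe_I]
  simp only [Algebra.algebraMap_self, RingHom.id_apply]
  rw [div_eq_iff hden]
  apply Complex.ext
  · simp
    field_simp
    linear_combination (-(g 1 0)) * hdet
  · simp
    field_simp
    linear_combination (g 1 1) * hdet

/-- **`cosh d(g • i, i) = (a² + b² + c² + d²) / 2`** for `g = (a b; c d) ∈ SL(2, ℝ)` (Mathlib's `cosh_dist` on `ℍ` +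
the explicit Möbius image of `i`; the Lagrange identity `(ac + bd)² + (ad − bc)² = (a² + b²)(c² + d²)`). -/
theorem cosh_dist_smul_I (g : SL(2, ℝ)) :
    Real.cosh (dist (g • I) I) = ((g 0 0) ^ 2 + (g 0 1) ^ 2 + (g 1 0) ^ 2 + (g 1 1) ^ 2) / 2 := by
  have hdet := det_entries g
  have hcd := row_ne_zero g
  have hcd' : (g 1 1) ^ 2 + (g 1 0) ^ 2 ≠ 0 := by rw [add_comm]; exact hcd
  rw [cosh_dist, I_im, ← UpperHalfPlane.coe_im, smul_I_eq, Complex.dist_eq, Complex.sq_norm]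
  simp only [Complex.normSq_apply, UpperHalfPlane.coe_I, Complex.sub_re, Complex.sub_im, Complex.I_re,
    Complex.I_im]
  field_simp
  ring_nf
  nlinarith [hdet]

/-- the cosh-size is half the squared Hilbert–Schmidt norm of the matrix: `κ g = (a² + b² + c² + d²) / 2`. -/
theorem κ_eq (g : SL(2, ℝ)) : κ g = ((g 0 0) ^ 2 + (g 0 1) ^ 2 + (g 1 0) ^ 2 + (g 1 1) ^ 2) / 2 :=
  cosh_dist_smul_I g

/-- `M x = √8 · κ x` is non-negative. -/
theorem M_nonneg (x : SL(2, ℝ)) : 0 ≤ Real.sqrt 8 * κ x :=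
  mul_nonneg (Real.sqrt_nonneg _) (κ_nonneg x)

/-- `M x = √8 · κ x` is locally bounded (continuous). -/
theorem M_locBdd (x₀ : SL(2, ℝ)) : ∃ U ∈ 𝓝 x₀, ∃ c : ℝ, ∀ x ∈ U, Real.sqrt 8 * κ x ≤ c :=
  PoincareKernel.size_locBdd_of_continuous (fun x => Real.sqrt 8 * κ x)
    (continuous_const.mul κ_continuous) x₀

variable {Γ : Type} (ι : Γ → SL(2, ℝ)) (f : SL(2, ℝ) → ℂ)

/-- **ABSOLUTE CONVERGENCE of the Poincaré series on `SL(2, ℝ)`** from a polynomial count in the cosh-size and a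
polynomial decay in the cosh-size, at every point `(x, y)`. -/
theorem summable_norm_kernel_SL2 {α β : ℝ} (hβ : 0 ≤ β) (hαβ : β < α)
    {C' : ℝ} (hcount : ∀ R : ℝ, 0 ≤ R →
      ∃ t : Finset Γ, (∀ γ, κ (ι γ) ≤ R → γ ∈ t) ∧ (t.card : ℝ) ≤ C' * (1 + R) ^ β)
    {C : ℝ} (hf : ∀ g, ‖f g‖ ≤ C * (1 + κ g) ^ (-α)) (x y : SL(2, ℝ)) :
    Summable fun γ => ‖f (x⁻¹ * ι γ * y)‖ :=
  PoincareKernel.summable_norm_shift_of_mul κ ι f κ_nonneg M_nonneg κ_shift hβ hαβ hcount hf x y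

/-- **CONTINUITY of the Poincaré-series kernel on `SL(2, ℝ) × SL(2, ℝ)`** (the real archimedean group of a `(1,1)`-place)
from the polynomial count in the cosh-size and the polynomial decay of a continuous `f`, `β < α`. -/
theorem continuous_kernelSum_SL2 (hfc : Continuous f) {α β : ℝ} (hβ : 0 ≤ β) (hαβ : β < α)
    {C' : ℝ} (hcount : ∀ R : ℝ, 0 ≤ R →
      ∃ t : Finset Γ, (∀ γ, κ (ι γ) ≤ R → γ ∈ t) ∧ (t.card : ℝ) ≤ C' * (1 + R) ^ β)
    {C : ℝ} (hf : ∀ g, ‖f g‖ ≤ C * (1 + κ g) ^ (-α)) :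
    Continuous (fun p : SL(2, ℝ) × SL(2, ℝ) => PoincareKernel.kernelSum ι f p.1 p.2) :=
  PoincareKernel.continuous_kernelSum_of_mul κ ι f hfc M_nonneg M_locBdd κ_nonneg κ_shift hβ hαβ hcount hf

end Summit.Ventures.HodgeRepro2.Tier7.Line3.HyperbolicSize
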